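import Summits.AtomisticToContinuum.HydrodynamicLimit.Theorems.CollisionIsometryCLTDiffuseBackwardInfluencePairDefs
import Summits.AtomisticToContinuum.HydrodynamicLimit.Theorems.CollisionIsometryCLTDiffuseBackwardInfluencePairGeneric
import Summits.AtomisticToContinuum.HydrodynamicLimit.Theorems.CollisionIsometryCLTDiffuseBackwardInfluenceRowBudgetN
import Summits.AtomisticToContinuum.HydrodynamicLimit.Theorems.CollisionIsometryCLTDiffuseBackwardInfluenceEntropyTransfer
import Summits.AtomisticToContinuum.HydrodynamicLimit.Theorems.CollisionIsometryCLTDiffuseBackwardInfluenceFewIdleSuperExp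
import Summits.AtomisticToContinuum.HydrodynamicLimit.Theorems.CollisionIsometryCLTDiffuseBackwardInfluenceOneFlightShareLD
import Summits.AtomisticToContinuum.HydrodynamicLimit.Theorems.CollisionIsometryCLTDiffuseBackwardInfluenceTubeLD
import Summits.AtomisticToContinuum.HydrodynamicLimit.Theorems.CollisionIsometryCLTDiffuseBackwardInfluenceStubStickLD
import Summits.AtomisticToContinuum.HydrodynamicLimit.Theorems.CollisionIsometryCLTDiffuseBackwardInfluenceConditional
import Summits.AtomisticToContinuum.HydrodynamicLimit.Theorems.DiffuseBackwardInfluence.Negative.FreeDirection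
import Literature.MathematicalPhysics.KineticTheory.HardSphereEulerProofs
import Literature.Analysis.FluidPDE.HardSphereFlowMeasurable
import HarnessLib

/-!
# Line `delayed-renewal` for crux `DiffuseBackwardInfluence` (stmt-AtomisticToContinuum-12950) — STRATEGIST'S ALTERNATIVE LINE
(planner-cstrat-stmt-AtomisticToContinuum-12950-s1-0, 2026-08-17; an `--alt` skeleton: it does NOT replace the lead's driven skeleton
`Lines/share_nondegeneracy_one_flight.lean` v7, whose vocabulary (landed `…PairDefs.lean`, `…PairGeneric.lean`) it imports and reuses)

## What this line changes relative to v7, and why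
v7 cuts the two-body input of the renewal decomposition into `RemergeBounded` (expected number of re-merges of the two tracers of a source
is bounded) and `CrossRemergeRare` (re-merges, within a slot, of pairs that were apart AT THE SLOT BOUNDARY have vanishing mean mass, for
every fixed grid). The second statement is TRUE but contains, with coefficient `≍ r₁(σ) ≍ σ³` (prompt same-pair re-collision
multiplicity, N-uniform and positive: `Cruxes/…/KinResults.md` M1/M3), the crux's own conclusion at the `S − 1` interior slot
boundaries: a pair that splits at the last collision of its host before `s_r` and re-merges at the prompt ring re-collision just after
`s_r` IS a cross-slot re-merge, and the mean mass of such events is `≍ r₁(σ) · P(together at s_r⁻)`, i.e. `σ³ ×` (the crux functional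
on the shifted window `[t − Δ_N, s_r]`). So, exactly as `stub_lateTouchRare` of v3–v6 was the crux WITH A RATE (crux NOTES §3/§7), v7's
`stub_crossRemergeRare` is — on that component — the crux AT INTERIOR TIMES: circular in effort as a decomposition (a prover of stub D
must run the whole renewal argument at the interior boundaries), although not false.

REPAIR (this line). The marked pair process of v7 already carries the TAG `g` of the current separation (the slot count at the split).
A cross-slot re-merge in slot `c` of a pair with tag `g = c − 1` (it separated DURING the previous slot: a "recent" excursion, which is
where all the boundary-straddling prompt re-merges live) costs the together-mass exactly ONE scoring opportunity (slot `c`'s: the pair was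
not on its host at `s_c`), so on the part of the process with `s < j₀` re-merges the recent excursions cost a score deficit `≤ j₀` in
total and are ABSORBED by the geometric supermartingale: exponent `mL − j₀` instead of `mL`. Only DELAYED re-merges — tag `g ≤ c − 2`,
i.e. the pair has been apart THROUGHOUT slot `c − 1` (an excursion of ≥ one full slot = `n_N/S → ∞` collision times) — can carry a large
deficit, and only their mass must be an input: `DelayedRemergeRare`. Canonically (without the marked process) the delayed re-merges of
slot `r` are the re-merges of the no-inflow pair transport `apartFrom` STARTED ONE SLOT EARLIER (at `s_{r−1}`) and run across slot
`r − 1` into slot `r` (`delayedRemAt` below); pathwise `delayedRemFr ≤ crossRemFr` (start the no-inflow transport later ⇒ more mass: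
`PairPath.offdiag_transport_mono` / `remerge_flow_mono`, landed), so `CrossRemergeRare → DelayedRemergeRare`: the new input is WEAKER
than v7's, and it is non-circular — its lower bound is the mass of re-merges after excursions of duration ≥ `Δ_N/S`, unrelated to the
together-probability at any time (pure N-uniform transience of the two hosts at diverging lag; physically `≍ σ⁶ (n_N/S)^{−1/2} → 0`).

## Stubs (6; sorries only here) and composition
* `stub_pairPathBoundD`  (L, PROVABLE pathwise bookkeeping): `PairPathBoundD` — v7's `PairPathBound` with `crossRemFr` replaced by
  `delayedRemFr` and exponent `mL − j₀` (tag-refined score-deficit accounting; all other devices = v7's: supermartingale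
  `Σ 2^{−s} ρ₁^{−t}·mass`, split moment `≤ totalRemFr`, charge deficit Markov at `mL`).
* `stub_delayedRemMeasurable` (M, PROVABLE, technical): measurability of `y ↦ delayedRemFr` (Alexander-construction measurability).
* `stub_remergeBounded` (conjecture-level; IDENTICAL to v7 stub C, shared): `PairPath.RemergeBounded`.
* `stub_delayedRemergeRare` (conjecture-level; NEW, weaker than v7 stub D): `DelayedRemergeRare`.
* `stub_nearSetLD` (conjecture-level; THE LEVER, IDENTICAL to v7 stub E, shared by every line): `ShareLD.NearSetLD` below `σ₀`.
* `stub_cruxCompositionD` (M, PROVABLE bookkeeping): the composition at the level of `CruxConclusionAt` — as v7's stub F with the two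
  replaced statements: on the good event (all `2mL` per-slot charges `≤ b`, probability → 1 by `shareLDAt_of_nearSetLD` p121117 +
  `FewIdleSuperExpAt` via `StickLD` p126388 + `stub_entropyTransfer` p87454) apply `PairPathBoundD`; off it `ipr ≤ 9` (`RowBudgetN`
  p87871); take expectations (`lintegral_add` needs `stub_delayedRemMeasurable`), feed `RemergeBounded` (choose `j₀ → ∞` slowly) and
  `DelayedRemergeRare` (fixed grid `2mL`), then `m → ∞`, `η`-bookkeeping as in `cruxConclusion_of_statements` (p126610's file).
`DiffuseBackwardInfluence_of` concludes the crux decl BY NAME (the crux's `let M`, `let ipr` are `DiffuseBackwardInfluenceNeg.transfer/ipr`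
definitionally, closed by `exact`).

## Disproof used (`Cruxes/DiffuseBackwardInfluence/Disproof.lean`, F0–F8; `-- Targets` empty)
F3 (idle rows keep weight 9; FewIdle NECESSARY) — idleness is the per-slot idle charge of `stub_pairPathBoundD`, super-exp rare by the
LANDED tube input (StickLD/TubeLD/FewIdleSuperExp); F4 (the fold step is an involution: no pathwise monotone functional) — nothing
pathwise-monotone in `M` is claimed: the supermartingale lives on the MARKED tracer-pair process and its decrease is repaid exactly by the
re-merge terms (`totalRemFr`, `delayedRemFr`) that the echo paths of TRIAGE-r1-3 maximise; F5/F7 (planar kernel keeps `ipr ≥ 1`; free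
directions) — normal non-degeneracy enters ONLY through the law, at `stub_nearSetLD` (degenerate first collisions are charged, never
assumed away); F8 (tightness at three fresh coordinate collisions) — consistent: the bound decays only through scored ND collisions;
F1/F2 carried (positivity of `Δ_N` redundant; `Δ_N → 0` not used). Landed Negative lemmas imported: `TransferKernels`, `FreeDirection`.
-/

namespace Summit.AtomisticToContinuum.HydrodynamicLimit.Cruxes.DiffuseBackwardInfluence.DelayedRenewal

open scoped BigOperators Topology ENNReal InnerProductSpace Classical
open Filter Set MeasureTheory
open Literature.Analysis.FluidPDE (Config HardSphereFlow collidePair)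
open Literature.MathematicalPhysics.KineticTheory (localGibbsLaw hsDiameter)
open Summit.AtomisticToContinuum.HydrodynamicLimit.Theorems.DiffuseBackwardInfluenceNeg
open Summit.AtomisticToContinuum.HydrodynamicLimit.Theorems.DiffuseBackwardInfluenceShare

noncomputable section

/-! ## §1 The canonical DELAYED re-merge functionals -/

section Canonical

variable (σ : ℝ) (N : ℕ)

/-- DELAYED RE-MERGE MASS at the `t`-th fold step of slot `r` (`r ≥ 1`): the probability that the two conditionally independent
tracers of `src` re-merge at fold step `slotStart r + t` having sat on different particles at EVERY fold step since the start of the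
PREVIOUS slot `r − 1` — i.e. the re-merges of v7's no-inflow pair transport `apartFrom` started one slot earlier and run across slot
`r − 1` into slot `r` (their excursion covers the two boundaries `s_{r−1}, s_r`: tag `≤ r − 2` in the marked process). For `r = 0` it
degenerates to `crossRemAt` at slot `0`, which vanishes (all pairs together at the window start); the sums below start at `r = 1`. -/
def delayedRemAt (y : Cfg N) (src : Fin (N + 1)) (Δ : ℝ) (S r t : ℕ) : ℝ :=
  let len : ℕ := slotStart σ N y Δ S r - slotStart σ N y Δ S (r - 1)
  let n : ℕ := slotStart σ N y Δ S (r - 1) + (len + t)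
  ∑ i : Fin (N + 1), ∑ i' : Fin (N + 1), ∑ j' : Fin (N + 1), apartFrom σ N y src Δ S (r - 1) (len + t) i' j' *
    (hopKernel σ N y src n i' i * hopKernel σ N y src n j' i)

/-- DELAYED RE-MERGE FRACTION of the window on the grid with `S` slots: the source average of the total mass of re-merges, during each
slot `r ∈ [1, S)`, of tracer pairs that were apart throughout the previous slot (pathwise `≤ crossRemFr`: the only two-body quantity of
this line that must tend to `0`). -/
def delayedRemFr (y : Cfg N) (Δ : ℝ) (S : ℕ) : ℝ :=
  ((N + 1 : ℕ) : ℝ)⁻¹ * ∑ src : Fin (N + 1), ∑ r ∈ Finset.Ico 1 S,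
    ∑ t ∈ Finset.range (slotStart σ N y Δ S (r + 1) - slotStart σ N y Δ S r), delayedRemAt σ N y src Δ S r t

end Canonical

/-! ## §2 The statements of the line -/

/-- THE PAIR-PATH BOUND WITH TAG-REFINED DEFICIT, PATHWISE (no measure theory): for every configuration `y`, window `Δ > 0`,
`η ∈ (0,1)`, `m, L, j₀ ≥ 1` and level `b`, if on each of the `2mL` slots the idle fraction plus the share-degeneracy score is `≤ b`, then
`ipr ≤ 9 · (2^{j₀} (1 − η(1−η))^{mL − j₀} + totalRemFr / j₀ + 2 b + 2 · delayedRemFr_{2mL})`.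
Content (v7's devices + one refinement): `ipr/9` is the source average of the together-mass of the two tracers at the end; in the marked
pair process (splits `s`, scores `t`, separation tag `g`) `Σ 2^{−s}(1 − η(1−η))^{−t}·mass` is non-increasing; `Σ s·(together mass) ≤
totalRemFr` (Markov at `s ≥ j₀`); the score deficit `2mL − t` of together-mass at the end is the number of slots at whose start the pair
was apart or whose host's first in-slot collision was idle/`η`-degenerate: the latter part is charged (`Σ_r idleFr_r + degFr_r ≤ 2mL·b`,
Markov at `mL` gives the `2b`), the former is `≤ 1` per RECENT excursion (tag `g = c − 1` or `c`: at most the re-merge slot's start is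
missed), hence `≤ s < j₀` on the good part, while a history with a DELAYED excursion (tag `≤ c − 2`) is charged wholesale to
`delayedRemFr` (the canonical identification `marked delayed re-merges = delayedRemAt` is the analogue of v7's for `crossRemAt`). -/
def PairPathBoundD (σ : ℝ) : Prop :=
  ∀ (N : ℕ) (y : Cfg N) (Δ : ℝ), 0 < Δ → ∀ η : ℝ, 0 < η → η < 1 →
    ∀ m L j₀ : ℕ, 1 ≤ m → 1 ≤ L → 1 ≤ j₀ → ∀ b : ℝ,
      (∀ r : ℕ, r < 2 * m * L → idleFr σ N y Δ (2 * m * L) r + degFr σ N y Δ (2 * m * L) r η ≤ b) →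
      ipr σ N y Δ ≤ 9 * ((2 : ℝ) ^ j₀ * (1 - η * (1 - η)) ^ (m * L - j₀) + totalRemFr σ N y Δ / (j₀ : ℝ) + 2 * b +
        2 * delayedRemFr σ N y Δ (2 * m * L))

/-- DELAYED RE-MERGES ARE RARE (the two-body TAIL input of this line, along the local-Gibbs-EVOLVED law): for every admissible window,
`t > 0`, every FIXED grid size `S ≥ 2` and `ε > 0`, eventually the expected delayed re-merge fraction is `≤ ε`. Content: the two hosts of
a tracer pair that has been apart for a full slot (`Δ_N/S`, i.e. `≍ n_N/S → ∞` mean free times) re-touch later with vanishing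
probability, uniformly in `N` — transience of the inter-host displacement in `d = 3` at DIVERGING lag (heuristic intensity
`≍ σ⁶ j^{−3/2}` at lag `j`, tail `≍ σ⁶ (n_N/S)^{−1/2}`); the number of separations is `O(1)` in mean (`RemergeBounded`). Unlike v7's
`CrossRemergeRareAt` it does NOT charge the prompt re-merges of pairs split just before a boundary, so it contains no multiple of the
crux functional at interior times. Implied by `CrossRemergeRareAt` (pathwise `delayedRemFr ≤ crossRemFr`). -/
def DelayedRemergeRareAt (σ : ℝ) (a₀ θ₀ : T3 → ℝ) (u₀ : T3 → V3) (Φ : (N : ℕ) → Flow σ N) : Prop :=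
  ∀ Δ : ℕ → ℝ, (∀ N, 0 < Δ N) → Tendsto Δ atTop (𝓝 0) →
    Tendsto (fun N : ℕ => Δ N * ((N + 1 : ℕ) : ℝ) ^ ((1 : ℝ) / 3)) atTop atTop →
    ∀ t : ℝ, 0 < t → ∀ S : ℕ, 2 ≤ S → ∀ ε : ℝ, 0 < ε →
      ∀ᶠ N : ℕ in atTop,
        ∫⁻ z, ENNReal.ofReal (delayedRemFr σ N ((Φ N).flow (t - Δ N) z) (Δ N) S)
            ∂(localGibbsLaw σ a₀ u₀ θ₀ N (Φ N)) ≤ ENNReal.ofReal ε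

/-- MEASURABILITY of the delayed re-merge fraction in the configuration (technical input of the composition: it lets the expectation of
`totalRemFr/j₀ + 2·delayedRemFr` split into the two two-body hypotheses). Provable from the measurability of the Alexander construction
(`Literature.Analysis.FluidPDE.HardSphereFlowMeasurable`). -/
def DelayedRemMeasurable (σ : ℝ) : Prop :=
  ∀ (N : ℕ) (Δ : ℝ) (S : ℕ), Measurable fun y : Cfg N => delayedRemFr σ N y Δ S

/-- **DELAYED RE-MERGES ARE RARE** for every nice profile, below a density threshold `σ₀(profiles)`, for every flow family
(conjecture-level two-body tail input of this line; weaker than v7's `PairPath.CrossRemergeRare`). Not in the tree or in print: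
N-uniform transience at diverging lag of the two hosts of a split tracer pair along the deterministic hard-sphere flow at fixed reduced
density. -/
@[conjecture] def DelayedRemergeRare : Prop :=
  ∀ (a₀ θ₀ : T3 → ℝ) (u₀ : T3 → V3), Continuous a₀ → Continuous θ₀ → Continuous u₀ →
    (∀ x, 0 < a₀ x) → (∀ x, 0 < θ₀ x) → ∃ σ₀ : ℝ, 0 < σ₀ ∧ ∀ σ : ℝ, 0 < σ → σ < σ₀ →
      ∀ Φ : (N : ℕ) → Flow σ N, DelayedRemergeRareAt σ a₀ θ₀ u₀ Φ

/-! ## §3 Registered stubs -/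

/-- STUB A′ (L, PROVABLE): the pair-path bound with tag-refined deficit, pathwise (see `PairPathBoundD`). -/
theorem stub_pairPathBoundD : ∀ σ : ℝ, RowBudgetN σ → PairPathBoundD σ := by
  sorry

/-- STUB B′ (M, PROVABLE, technical): measurability of the delayed re-merge fraction (see `DelayedRemMeasurable`). -/
theorem stub_delayedRemMeasurable : ∀ σ : ℝ, σ < 1 / 2 → DelayedRemMeasurable σ := by
  sorry

/-- STUB C (XL, CONJECTURE-LEVEL two-body input 1 — IDENTICAL to the driven line's stub C, shared): re-merges are bounded in mean along
the evolved law (`PairPath.RemergeBounded`, landed statement in `…PairDefs.lean`). -/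
theorem stub_remergeBounded : PairPath.RemergeBounded := by
  sorry

/-- STUB D′ (XL, CONJECTURE-LEVEL two-body input 2 — NEW, weaker than the driven line's stub D): delayed re-merges are rare along the
evolved law (see `DelayedRemergeRareAt`). -/
theorem stub_delayedRemergeRare : DelayedRemergeRare := by
  sorry

/-- STUB E (XL, HARDEST — THE LEVER, IDENTICAL to the driven line's stub E, shared by every line of this crux): the prescribed-set
directional large deviation `ShareLD.NearSetLD` below a density threshold. -/
theorem stub_nearSetLD :
    ∃ σ₀ : ℝ, 0 < σ₀ ∧ ∀ σ : ℝ, 0 < σ → σ < σ₀ → ∀ θ : ℝ, 0 < θ → ShareLD.NearSetLD σ θ := by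
  sorry

/-- STUB F′ (M, PROVABLE bookkeeping): the composition of this line, at the level of `CruxConclusionAt`. -/
theorem stub_cruxCompositionD : (∀ σ : ℝ, RowBudgetN σ → PairPathBoundD σ) → (∀ σ : ℝ, σ < 1 / 2 → DelayedRemMeasurable σ) → (∃ σ₀ : ℝ, 0 < σ₀ ∧ ∀ σ : ℝ, 0 < σ → σ < σ₀ → ∀ θ : ℝ, 0 < θ → ShareLD.NearSetLD σ θ) → PairPath.RemergeBounded → DelayedRemergeRare → ∀ (a₀ θ₀ : T3 → ℝ) (u₀ : T3 → V3), Continuous a₀ → Continuous θ₀ → Continuous u₀ → (∀ x, 0 < a₀ x) → (∀ x, 0 < θ₀ x) → ∃ σ₀ : ℝ, 0 < σ₀ ∧ ∀ σ : ℝ, 0 < σ → σ < σ₀ → ∀ Φ : (N : ℕ) → Flow σ N, CruxConclusionAt σ a₀ θ₀ u₀ Φ := by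
  sorry

/-! ## §4 The skeleton theorem -/

/-- THE SKELETON THEOREM (concludes the crux decl BY NAME, no hypotheses; `sorry` lives only in the six registered stubs above; the
crux's `let M`, `let ipr` are `DiffuseBackwardInfluenceNeg.transfer/ipr` definitionally, closed by `exact`). -/
theorem DiffuseBackwardInfluence_of :
    Summit.AtomisticToContinuum.HydrodynamicLimit.Theses.CollisionIsometryCLT.DiffuseBackwardInfluence := by
  intro a₀ θ₀ u₀ ha hθ hu ha0 hθ0
  obtain ⟨σ₀, hσ₀, H⟩ := stub_cruxCompositionD stub_pairPathBoundD stub_delayedRemMeasurable stub_nearSetLD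
    stub_remergeBounded stub_delayedRemergeRare a₀ θ₀ u₀ ha hθ hu ha0 hθ0
  refine ⟨σ₀, hσ₀, ?_⟩
  intro σ hσ hσlt M ipr' Φ Δ hΔ hΔ0 hΔ1 t ht
  exact H σ hσ hσlt Φ Δ hΔ hΔ0 hΔ1 t ht

end

end Summit.AtomisticToContinuum.HydrodynamicLimit.Cruxes.DiffuseBackwardInfluence.DelayedRenewal
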